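import Literature.Algebra.Homology.DiscreteRepEnoughInjectives
import Literature.Algebra.Homology.DiscreteRepInvariants
import Mathlib.Topology.LocallyConstant.Algebra
import Mathlib.Algebra.Category.ModuleCat.EnoughInjectives
import Mathlib.Algebra.Homology.DerivedCategory.Ext.EnoughInjectives
import HarnessLib

/-!
# Co-induced discrete modules `V ↦ LocallyConstant Γ V` over a COMPACT group and their
# `Ext`-acyclicity: `Extⁿ_{C_Γ}(k, CoInd V) = 0` for `n ≥ 1`

Topic `Algebra/Homology`; namespace `Literature.Algebra.Homology.DiscreteRep`.  Definitions with bodies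
and theorems; no named fact, no `sorry`.  Sequel of `DiscreteRepCategory` / `DiscreteRepEnoughInjectives` /
`DiscreteRepInvariants` (the abelian category `C_Γ = DiscreteRepCat k Γ` of representations of a
topological group `Γ` with open stabilisers, its `Ext`, the trivial objects `triv V`), written for
Route A of the Poitou–Tate programme of crux `stmt-BirchSwinnertonDyer-19295` (cell
`bsd-schneider-ideate`, seat door-c4 gen 13), step G5′-ii: it supplies the ACYCLIC objects for the
comparison `Extⁿ_{C_Γ}(k, M) ≅ Hⁿ_cont(Γ, M)` (Harari, Remark 4.24: "`H^q(G, I) = 0` … as `I^U` is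
injective" — here replaced by the classical acyclicity of (co-)induced modules, Serre, *Cohomologie
galoisienne* I §2.5, Corollaire to Prop. 10 (held copy p. 15): «La cohomologie d'un module induit est
nulle en dimension ≥ 1»).

For a `k`-module `V` (no action) the **co-induced discrete representation** is the module
`LocallyConstant Γ V` of locally constant maps `Γ → V` with `(g • f)(x) = f(g⁻¹ x)`.  When `Γ` is
COMPACT every `f` is uniformly locally constant (`f(w x) = f(x)` for `w` in a neighbourhood of `1`;
Mathlib `compact_open_separated_mul_left` on the finitely many fibres), so its stabiliser is open:
`CoInd V ∈ C_Γ`.  Frobenius reciprocity `Hom_{C_Γ}(A, CoInd V) ≃ Hom_k(A, V)` (`φ ↦ (a ↦ φ(a)(1))`,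
inverse `ψ ↦ (a ↦ (x ↦ ψ(x⁻¹ a)))`, locally constant because `stab(a)` is open) makes
`CoInd : Mod_k ⥤ C_Γ` RIGHT ADJOINT to the forgetful functor; hence `CoInd` preserves injectives
(the forgetful functor preserves monomorphisms) and is exact (left exact as a right adjoint;
surjections lift through any set-theoretic section).  From an injective presentation
`0 → V → J → Q → 0` in `Mod_k` and the long exact `Ext(k, –)`-sequence of
`0 → CoInd V → CoInd J → CoInd Q → 0`: `Ext¹(k, CoInd V) = 0` because `Hom(k, CoInd J) → Hom(k, CoInd Q)`
is `J → Q`, onto; and `Ext^{q+2}(k, CoInd V) ≅ Ext^{q+1}(k, CoInd Q) = 0` by induction (all `V` at once).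

## What is here
* `coindRepr V`, `coindRep V`, `exists_nhds_one_forall_apply_mul_eq` (uniform local constancy on a
  compact group), **`isDiscrete_coindRep`**, `coind V : DiscreteRepCat k Γ`, `coindFunctor`.
* `isLocallyConstant_ρ_inv_apply`, `coindLift`, `coindHomEquiv` (Frobenius reciprocity),
  **`forgetCoindAdjunction : ι ⋙ forget₂ ⊣ coindFunctor`**, `injective_coind`.
* `epi_coindFunctor_map_of_surjective`, `shortExact_map_coindFunctor` (exactness).
* `exists_ext₀_comp_eq` (surjectivity of `Ext⁰(k, CoInd J) → Ext⁰(k, CoInd Q)`) and the main theorem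
  **`ext_triv_coind_eq_zero : Ext^{q+1}_{C_Γ}(triv k, coind V) = 0`** for every `k`-module `V`, `q ≥ 0`.

Not here: the identification of Mathlib's `TopRep.coind₁` (continuous maps `C(Γ, M)` with the twisted
action) with `coind M` for `M` discrete — file `DiscreteRepStandardResolution`.

## References
* J.-P. Serre, *Galois Cohomology*, Springer (1997), I §2.5. [SerreGaloisCohomology1997]
* D. Harari, *Galois Cohomology and Class Field Theory* (2020), §4.3, Remark 4.24. [Harari2020]
-/

-- CITATION-FIX (2026-08-27, door-c4 g13; referee flag Q-g49-1): the header formerly put a French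
-- PARAPHRASE in quotation marks («Les modules induits sont cohomologiquement triviaux») as if verbatim
-- Serre I §2.5; replaced by the verbatim Corollaire of the held copy (`book:serre1997-galois-cohomology`,
-- p. 15, l. 3).  Declarations unchanged.

noncomputable section

universe u

namespace Literature.Algebra.Homology

namespace DiscreteRep

open CategoryTheory CategoryTheory.Limits CategoryTheory.Abelian Filter
open scoped _root_.Topology Pointwise

variable {k Γ : Type u} [CommRing k] [Group Γ] [TopologicalSpace Γ] [IsTopologicalGroup Γ]

/-! ## §1 The co-induced representation on `LocallyConstant Γ V` -/

section CoindRep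

variable (V : Type u) [AddCommGroup V] [Module k V]

variable (k Γ) in
/-- **The co-induced representation** of `Γ` on the locally constant maps `Γ → V`:
`(g • f)(x) = f(g⁻¹ x)`. [cite: SerreGaloisCohomology1997, I §2.5] -/
def coindRepr : Representation k Γ (LocallyConstant Γ V) where
  toFun g := LocallyConstant.comapₗ k (⟨fun x => g⁻¹ * x, continuous_const_mul g⁻¹⟩ : C(Γ, Γ))
  map_one' := by
    refine LinearMap.ext fun f => LocallyConstant.ext fun x => ?_
    simp
  map_mul' g h := by
    refine LinearMap.ext fun f => LocallyConstant.ext fun x => ?_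
    simp [mul_assoc]

/-- Formula: `(coindRepr k Γ V g f) x = f (g⁻¹ * x)`. [cite: SerreGaloisCohomology1997, I §2.5] -/
@[simp]
theorem coindRepr_apply_apply (g : Γ) (f : LocallyConstant Γ V) (x : Γ) :
    coindRepr k Γ V g f x = f (g⁻¹ * x) := rfl

variable (k Γ) in
/-- The co-induced representation as an object of `Rep k Γ`. [cite: SerreGaloisCohomology1997, I §2.5] -/
abbrev coindRep : Rep.{u} k Γ := Rep.of (coindRepr k Γ V)

omit [IsTopologicalGroup Γ] in
/-- **Uniform local constancy on a compact group**: a locally constant map `f` on a compact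
topological group satisfies `f (w * x) = f x` for all `x` and all `w` in some neighbourhood of `1`
(apply Mathlib's `compact_open_separated_mul_left` to the finitely many (compact, open) fibres of
`f`). [cite: SerreGaloisCohomology1997, I §2.5] -/
theorem exists_nhds_one_forall_apply_mul_eq [IsTopologicalGroup Γ] [CompactSpace Γ] {Y : Type*}
    (f : LocallyConstant Γ Y) : ∃ W ∈ 𝓝 (1 : Γ), ∀ w ∈ W, ∀ x, f (w * x) = f x := by
  have key : ∀ y : Y, ∃ W ∈ 𝓝 (1 : Γ), W * (f ⁻¹' {y}) ⊆ f ⁻¹' {y} := fun y =>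
    compact_open_separated_mul_left (f.isLocallyConstant.isClosed_fiber y).isCompact
      (f.isLocallyConstant.isOpen_fiber y) subset_rfl
  choose W hW hWsub using key
  refine ⟨⋂ y ∈ Set.range f, W y, (Filter.biInter_mem f.range_finite).2 (fun y _ => hW y),
    fun w hw x => ?_⟩
  have hx : x ∈ (f : Γ → Y) ⁻¹' {f x} := rfl
  exact hWsub (f x) (Set.mul_mem_mul (Set.mem_iInter₂.1 hw (f x) ⟨x, rfl⟩) hx)

/-- **For `Γ` compact the co-induced representation is DISCRETE** (every stabiliser is open: it
contains the inverse of a neighbourhood of `1` on which `f` is uniformly locally constant).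
[cite: SerreGaloisCohomology1997, I §2.5] -/
theorem isDiscrete_coindRep [CompactSpace Γ] : IsDiscrete (coindRep k Γ V) := fun f => by
  obtain ⟨W, hW, hWf⟩ := exists_nhds_one_forall_apply_mul_eq f
  apply Subgroup.isOpen_of_mem_nhds (g := 1)
  have hW' : W⁻¹ ∈ 𝓝 (1 : Γ) := inv_mem_nhds_one Γ hW
  refine Filter.mem_of_superset hW' fun g hg => ?_
  rw [SetLike.mem_coe, mem_stabilizer_iff]
  refine LocallyConstant.ext fun x => ?_
  exact hWf g⁻¹ (Set.mem_inv.1 hg) x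

variable (k Γ) in
/-- The co-induced representation as an object of `C_Γ` (`Γ` compact).
[cite: SerreGaloisCohomology1997, I §2.5] -/
abbrev coind [CompactSpace Γ] : DiscreteRepCat k Γ := mk (coindRep k Γ V) (isDiscrete_coindRep V)

end CoindRep

/-! ## §2 Frobenius reciprocity `Hom_{C_Γ}(A, CoInd V) ≃ Hom_k(A, V)` -/

section Reciprocity

variable [CompactSpace Γ] (A : DiscreteRepCat k Γ) {V : Type u} [AddCommGroup V] [Module k V]

omit [CompactSpace Γ] in
/-- For a discrete representation `A` and `a ∈ A`, the orbit map `x ↦ ρ(x⁻¹) a` is locally constant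
(it is constant on the open cosets `stab(a) · x`). [cite: SerreGaloisCohomology1997, I §2.5] -/
theorem isLocallyConstant_ρ_inv_apply (a : A.obj.V) :
    IsLocallyConstant (fun x : Γ => A.obj.ρ x⁻¹ a) := by
  refine (IsLocallyConstant.iff_eventually_eq _).2 fun x => ?_
  have h1 : (fun y : Γ => y * x⁻¹) ⁻¹' (stabilizer A.obj a : Set Γ) ∈ 𝓝 x :=
    ((A.property a).preimage (continuous_id.mul continuous_const)).mem_nhds (by simp)
  filter_upwards [h1] with y hy
  have hy' : A.obj.ρ (y * x⁻¹)⁻¹ a = a := (mem_stabilizer_iff _ _ _).1 ((stabilizer A.obj a).inv_mem hy)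
  have : y⁻¹ = x⁻¹ * (y * x⁻¹)⁻¹ := by group
  rw [this, map_mul, Module.End.mul_apply, hy']

/-- The equivariant map `A → CoInd V` attached to a linear map `ψ : A → V`:
`a ↦ (x ↦ ψ (ρ(x⁻¹) a))`. [cite: SerreGaloisCohomology1997, I §2.5] -/
def coindLift (ψ : A.obj.V →ₗ[k] V) : A ⟶ coind k Γ V :=
  ObjectProperty.homMk (Rep.ofHom
    ⟨{ toFun := fun a => ⟨fun x => ψ (A.obj.ρ x⁻¹ a), (isLocallyConstant_ρ_inv_apply A a).comp ψ⟩
       map_add' := fun a b => LocallyConstant.ext fun x => by simp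
       map_smul' := fun c a => LocallyConstant.ext fun x => by simp },
     fun g => LinearMap.ext fun a => LocallyConstant.ext fun x => by
       simp [mul_inv_rev, map_mul]⟩)

/-- Formula: `(coindLift A ψ) a x = ψ (ρ(x⁻¹) a)`. [cite: SerreGaloisCohomology1997, I §2.5] -/
@[simp]
theorem coindLift_apply_apply (ψ : A.obj.V →ₗ[k] V) (a : A.obj.V) (x : Γ) :
    (coindLift A ψ).hom.hom a x = ψ (A.obj.ρ x⁻¹ a) := rfl

/-- The linear map `A → V` attached to an equivariant map `φ : A → CoInd V`: `a ↦ φ(a)(1)`.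
[cite: SerreGaloisCohomology1997, I §2.5] -/
def coindEval (φ : A ⟶ coind k Γ V) : A.obj.V →ₗ[k] V :=
  (LocallyConstant.evalₗ k (1 : Γ)) ∘ₗ φ.hom.hom.toLinearMap

/-- Formula: `coindEval A φ a = φ a 1`. [cite: SerreGaloisCohomology1997, I §2.5] -/
@[simp]
theorem coindEval_apply (φ : A ⟶ coind k Γ V) (a : A.obj.V) : coindEval A φ a = φ.hom.hom a 1 := rfl

/-- **Frobenius reciprocity**: `Hom_{C_Γ}(A, CoInd V) ≃ Hom_k(A, V)`.
[cite: SerreGaloisCohomology1997, I §2.5] -/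
def coindHomEquiv : (A ⟶ coind k Γ V) ≃ (A.obj.V →ₗ[k] V) where
  toFun := coindEval A
  invFun := coindLift A
  left_inv φ := ObjectProperty.hom_ext _ (Rep.hom_ext (DFunLike.ext _ _ fun a =>
    LocallyConstant.ext fun x => by
      change φ.hom.hom (A.obj.ρ x⁻¹ a) 1 = φ.hom.hom a x
      rw [Rep.hom_comm_apply]
      simp))
  right_inv ψ := LinearMap.ext fun a => by
    change ψ (A.obj.ρ (1 : Γ)⁻¹ a) = ψ a
    rw [inv_one, map_one, Module.End.one_apply]

end Reciprocity

/-! ## §3 The functor `CoInd : Mod_k ⥤ C_Γ` and the adjunction `forget ⊣ CoInd` -/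

section Functor

variable [CompactSpace Γ]

variable (k Γ) in
/-- **The co-induction functor `Mod_k ⥤ C_Γ`** (`V ↦ LocallyConstant Γ V`, maps by
post-composition). [cite: SerreGaloisCohomology1997, I §2.5] -/
def coindFunctor : ModuleCat.{u} k ⥤ DiscreteRepCat k Γ where
  obj V := coind k Γ V
  map f := ObjectProperty.homMk (Rep.ofHom
    ⟨LocallyConstant.mapₗ k f.hom, fun _ => LinearMap.ext fun _ => LocallyConstant.ext fun _ => rfl⟩)
  map_id _ := ObjectProperty.hom_ext _ (Rep.hom_ext (DFunLike.ext _ _ fun _ => rfl))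
  map_comp _ _ := ObjectProperty.hom_ext _ (Rep.hom_ext (DFunLike.ext _ _ fun _ => rfl))

/-- On objects: `(coindFunctor k Γ).obj V = coind k Γ V`. [cite: SerreGaloisCohomology1997, I §2.5] -/
@[simp]
theorem coindFunctor_obj (V : ModuleCat.{u} k) : (coindFunctor k Γ).obj V = coind k Γ V := rfl

/-- On morphisms: post-composition. [cite: SerreGaloisCohomology1997, I §2.5] -/
@[simp]
theorem coindFunctor_map_apply {V W : ModuleCat.{u} k} (f : V ⟶ W) (h : LocallyConstant Γ V) :
    ((coindFunctor k Γ).map f).hom.hom h = h.map f.hom := rfl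

/-- Naturality of the reciprocity in `V`: `eval₁ (φ ≫ CoInd g) = g ∘ eval₁ φ`.
[cite: SerreGaloisCohomology1997, I §2.5] -/
theorem coindEval_comp (A : DiscreteRepCat k Γ) {V W : ModuleCat.{u} k} (φ : A ⟶ coind k Γ V)
    (g : V ⟶ W) : coindEval A (φ ≫ (coindFunctor k Γ).map g) = g.hom ∘ₗ coindEval A φ := rfl

variable (k Γ) in
/-- **`forget ⊣ CoInd`**: the co-induction functor is right adjoint to the forgetful functor
`C_Γ ⥤ Rep k Γ ⥤ Mod_k` (Frobenius reciprocity, natural in both variables).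
[cite: SerreGaloisCohomology1997, I §2.5] -/
def forgetCoindAdjunction :
    (ι k Γ ⋙ forget₂ (Rep.{u} k Γ) (ModuleCat.{u} k)) ⊣ coindFunctor k Γ :=
  Adjunction.mkOfHomEquiv
    { homEquiv := fun A V =>
        { toFun := fun f => coindLift A f.hom
          invFun := fun φ => ModuleCat.ofHom (coindEval A φ)
          left_inv := fun f => by
            apply ModuleCat.hom_ext
            exact (coindHomEquiv A).right_inv f.hom
          right_inv := fun φ => (coindHomEquiv A).left_inv φ }
      homEquiv_naturality_left_symm := fun _ _ => rfl
      homEquiv_naturality_right := fun _ _ => ObjectProperty.hom_ext _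
        (Rep.hom_ext (DFunLike.ext _ _ fun _ => rfl)) }

/-- `CoInd` is a right adjoint. [cite: SerreGaloisCohomology1997, I §2.5] -/
instance : (coindFunctor k Γ).IsRightAdjoint := (forgetCoindAdjunction k Γ).isRightAdjoint

/-- `CoInd` preserves all (small) limits. [cite: SerreGaloisCohomology1997, I §2.5] -/
instance : PreservesLimitsOfSize.{0, 0} (coindFunctor k Γ) :=
  (forgetCoindAdjunction k Γ).rightAdjoint_preservesLimits

/-- The forgetful functor `C_Γ ⥤ Mod_k` preserves monomorphisms (monos are the injective maps on
both sides). [cite: Harari2020, §4.2] -/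
instance : (ι k Γ ⋙ forget₂ (Rep.{u} k Γ) (ModuleCat.{u} k)).PreservesMonomorphisms where
  preserves f hf := by
    rw [ModuleCat.mono_iff_injective]
    exact (Rep.mono_iff_injective ((ι k Γ).map f)).1 inferInstance

/-- **`CoInd J` is injective in `C_Γ` for `J` an injective `k`-module** (right adjoint of a
mono-preserving functor). [cite: Harari2020, §4.3 and Appendix, Proposition A.34] -/
theorem injective_coind (J : ModuleCat.{u} k) [Injective J] : Injective ((coindFunctor k Γ).obj J) :=
  (forgetCoindAdjunction k Γ).map_injective J inferInstance

/-- `CoInd` maps surjections to epimorphisms (lift through a set-theoretic section: every map out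
of a discrete space is locally constant after a locally constant one).
[cite: SerreGaloisCohomology1997, I §2.5] -/
theorem epi_coindFunctor_map_of_surjective {V W : ModuleCat.{u} k} (g : V ⟶ W)
    (hg : Function.Surjective g.hom) : Epi ((coindFunctor k Γ).map g) := by
  apply (ι k Γ).epi_of_epi_map
  rw [Rep.epi_iff_surjective]
  intro (h : LocallyConstant Γ W)
  refine ⟨h.map (Function.surjInv hg), LocallyConstant.ext fun x => ?_⟩
  change g.hom (Function.surjInv hg (h x)) = h x
  exact Function.surjInv_eq hg (h x)

/-- **`CoInd` is exact**: it carries short exact sequences of `k`-modules to short exact sequences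
of `C_Γ`. [cite: SerreGaloisCohomology1997, I §2.5] -/
theorem shortExact_map_coindFunctor {S : ShortComplex (ModuleCat.{u} k)} (hS : S.ShortExact) :
    (S.map (coindFunctor k Γ)).ShortExact where
  exact := hS.exact.map_of_mono_of_preservesKernel (coindFunctor k Γ) hS.mono_f inferInstance
  mono_f := by
    haveI := hS.mono_f
    exact (coindFunctor k Γ).map_mono S.f
  epi_g := by
    haveI := hS.epi_g
    exact epi_coindFunctor_map_of_surjective S.g ((ModuleCat.epi_iff_surjective S.g).1 inferInstance)

end Functor

/-! ## §4 `Ext`-acyclicity of co-induced modules -/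

section Acyclic

variable [CompactSpace Γ]

/-- `Ext⁰(k, CoInd J) → Ext⁰(k, CoInd Q)` is onto for `J ↠ Q` (the map `k → Q` given by a class
lifts to `k → J` because `k` is free). [cite: SerreGaloisCohomology1997, I §2.5] -/
theorem exists_ext₀_comp_eq {V W : ModuleCat.{u} k} (g : V ⟶ W) (hg : Function.Surjective g.hom)
    (x : Ext (triv (Γ := Γ) k) ((coindFunctor k Γ).obj W) 0) :
    ∃ y : Ext (triv (Γ := Γ) k) ((coindFunctor k Γ).obj V) 0,
      y.comp (Ext.mk₀ ((coindFunctor k Γ).map g)) (add_zero 0) = x := by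
  obtain ⟨v, hv⟩ := hg (coindEval _ (Ext.addEquiv₀ x) 1)
  refine ⟨Ext.mk₀ (coindLift (triv k) (LinearMap.toSpanSingleton k V v)), ?_⟩
  rw [Ext.mk₀_comp_mk₀, ← Ext.mk₀_addEquiv₀_apply x]
  congr 1
  apply (coindHomEquiv (triv (Γ := Γ) k)).injective
  change coindEval _ (coindLift (triv k) _ ≫ (coindFunctor k Γ).map g) = coindEval _ (Ext.addEquiv₀ x)
  rw [coindEval_comp]
  refine LinearMap.ext_ring ?_
  rw [LinearMap.comp_apply]
  change g.hom (coindHomEquiv (triv k) ((coindHomEquiv (triv k)).symm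
    (LinearMap.toSpanSingleton k V v)) 1) = _
  rw [Equiv.apply_symm_apply, LinearMap.toSpanSingleton_apply, one_smul, hv]

/-- **Co-induced modules are `Ext(k, –)`-acyclic: `Ext^{q+1}_{C_Γ}(triv k, CoInd V) = 0`** for
every `k`-module `V` and every `q` (`Γ` compact; functor form).  Induction on `q` over an injective
presentation `0 → V → J → Q → 0` of `V`: `CoInd J` is injective, `0 → CoInd V → CoInd J → CoInd Q → 0`
is exact, `Ext¹` dies because `Ext⁰(k, CoInd J) → Ext⁰(k, CoInd Q)` is onto, and `Ext^{q+2}(k, CoInd V)`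
is a quotient of `Ext^{q+1}(k, CoInd Q) = 0`.
[cite: SerreGaloisCohomology1997, I §2.5][cite: Harari2020, §4.3, Remark 4.24] -/
theorem ext_triv_coindFunctor_obj_eq_zero (q : ℕ) (V : ModuleCat.{u} k)
    (e : Ext (triv (Γ := Γ) k) ((coindFunctor k Γ).obj V) (q + 1)) : e = 0 := by
  induction q generalizing V with
  | zero =>
    let S : ShortComplex (ModuleCat.{u} k) :=
      ShortComplex.mk (Injective.ι V) (cokernel.π (Injective.ι V)) (cokernel.condition _)
    have hS : S.ShortExact := { exact := ShortComplex.exact_cokernel (Injective.ι V) }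
    have hS' : (ShortComplex.mk ((coindFunctor k Γ).map S.f) ((coindFunctor k Γ).map S.g)
        (by rw [← Functor.map_comp, S.zero, Functor.map_zero])).ShortExact :=
      shortExact_map_coindFunctor (Γ := Γ) hS
    haveI : Injective ((coindFunctor k Γ).obj S.X₂) := injective_coind (Injective.under V)
    obtain ⟨x, rfl⟩ := Ext.covariant_sequence_exact₁ (X := triv (Γ := Γ) k) (hS := hS') e
      (Ext.eq_zero_of_injective _) (zero_add 1)
    obtain ⟨y, rfl⟩ := exists_ext₀_comp_eq (Γ := Γ) S.g
      ((ModuleCat.epi_iff_surjective S.g).1 hS.epi_g) x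
    rw [Ext.comp_assoc_of_second_deg_zero, hS'.comp_extClass, Ext.comp_zero]
  | succ q ih =>
    let S : ShortComplex (ModuleCat.{u} k) :=
      ShortComplex.mk (Injective.ι V) (cokernel.π (Injective.ι V)) (cokernel.condition _)
    have hS : S.ShortExact := { exact := ShortComplex.exact_cokernel (Injective.ι V) }
    have hS' : (ShortComplex.mk ((coindFunctor k Γ).map S.f) ((coindFunctor k Γ).map S.g)
        (by rw [← Functor.map_comp, S.zero, Functor.map_zero])).ShortExact :=
      shortExact_map_coindFunctor (Γ := Γ) hS
    haveI : Injective ((coindFunctor k Γ).obj S.X₂) := injective_coind (Injective.under V)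
    obtain ⟨x, rfl⟩ := Ext.covariant_sequence_exact₁ (X := triv (Γ := Γ) k) (hS := hS') e
      (Ext.eq_zero_of_injective _) rfl
    rw [ih _ x, Ext.zero_comp]

/-- **`Ext^{q+1}_{C_Γ}(triv k, coind k Γ V) = 0`** (object form of `ext_triv_coindFunctor_obj_eq_zero`).
[cite: SerreGaloisCohomology1997, I §2.5] -/
theorem ext_triv_coind_eq_zero (q : ℕ) (V : Type u) [AddCommGroup V] [Module k V]
    (e : Ext (triv (Γ := Γ) k) (coind k Γ V) (q + 1)) : e = 0 :=
  ext_triv_coindFunctor_obj_eq_zero q (ModuleCat.of k V) e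

/-- Transport: any object of `C_Γ` isomorphic to a co-induced module is `Ext(k, –)`-acyclic.
[cite: SerreGaloisCohomology1997, I §2.5] -/
theorem ext_triv_eq_zero_of_iso_coind {M : DiscreteRepCat k Γ} {V : Type u} [AddCommGroup V]
    [Module k V] (e : M ≅ coind k Γ V) (q : ℕ) (x : Ext (triv (Γ := Γ) k) M (q + 1)) : x = 0 := by
  have h : x.comp (Ext.mk₀ e.hom) (add_zero _) = 0 := ext_triv_coind_eq_zero q V _
  have := congrArg (fun y => y.comp (Ext.mk₀ e.inv) (add_zero _)) h
  simpa only [Ext.comp_assoc_of_second_deg_zero, Ext.mk₀_comp_mk₀, Iso.hom_inv_id,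
    Ext.comp_mk₀_id, Ext.zero_comp] using this

end Acyclic

end DiscreteRep

end Literature.Algebra.Homology
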